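import Summits.NavierStokesRegularity.FunctionalMining.TopEigGapCoerciveTwo
import Summits.NavierStokesRegularity.FunctionalMining.TopEigHeatDanskin
import Summits.NavierStokesRegularity.FunctionalMining.TopEigProductionReverse
import Summits.NavierStokesRegularity.FunctionalMining.TopEigHeatCoerciveGap
import Summits.NavierStokesRegularity.FunctionalMining.StrainEigContinuous
import HarnessLib

/-!
# FunctionalMining / NoGo — K48: PORTRAIT OF AN EXACT (F2) WITNESS — balanced Danskin mass, a
# NON-SIMPLE top strain eigenvalue somewhere (`q = 2`; every `q` with gap-positivity), "stationary
# ⇒ flat a.e."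

HONEST FRAMING. Search for candidate a priori estimates; no regularity claim. Nothing about
Navier–Stokes is proved or asserted in this file. Cell `pub-nsfunc`, no-go seat (gen 50, touch 7).
It types, with proof, what the treeʼs kernel theorems force on an EXACT witness against the open
node Lemma L-λ(q) (`TopEigHeatCoercivePos q`; door (b)/(F2) of the cell = the WANTED kernel
negation): a smooth divergence-free zero-mean field `v` on `T³` with `Φ_q(v) = ∫(λ₁⁺)^q > 0` and
`heatDissipation Φ_q v = 0` (K46 `NoGo/TopEigHeatFiniteDim`: inside every finite-dimensional design
a rate-killing family contains such an exact member or is uniformly coercive). Sources in the tree: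
Danskinʼs formula `heatDissipation Φ_q v = −∫ q λ₁^{q−1} μ(S;ΔS)` (`TopEigHeatDanskin`), the heat
sieve `heatDissipation ≥ 0` in Danskin form (`integral_danskinDensity_laplacian_nonpos`,
`TopEigProductionReverse`, dict seat), and Proposition L-λ(η) IN THE KERNEL at `q = 2`
on the whole top-gap class (`TopEigGapCoerciveTwo.topEigMoment_two_le_heatDissipation_of_gap`,
prove seat: rate `2π²η/9` on `λ₂ ≤ (1−η)λ₁`, zeros of the strain allowed); for general `q` the
gap-positivity `∀ η > 0, TopEigGapCoercivePos q η` enters as a HYPOTHESIS (discharged for every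
real `q ≥ 2` by the treeʼs `topEigGapCoercivePos_of_ge_two`, `TopEigGapCoerciveHigh`, not imported
here).

CONTENT (namespace `TopEig`; `λ₁ = torusStrainTopEig`, `λ₂ = torusStrainMidEig`,
`μ(x) = dirTopEig (S v x) (S (Δv) x)`):
* § 1 (any `d`, compactness) `exists_strainGapClass_of_midEig_lt` — a smooth field with `λ₂ < λ₁` at
  EVERY point of the compact torus lies in some top-gap class `η ∈ (0, 1]`; contrapositive
  `exists_not_simple_of_forall_not_strainGapClass` — a field outside every gap class has a point
  with `λ₁ ≤ λ₂`; on `T³` (`exists_twin_of_forall_not_strainGapClass`, with `λ₂ ≤ λ₁`) a TWIN POINT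
  `λ₂ = λ₁`, zeros of the strain included.
* § 2 `integral_danskinDensity_eq_zero_of_exact` — an exact witness has BALANCED Danskin mass
  `∫ q λ₁^{q−1} μ = 0` (every admissible field has `∫ q λ₁^{q−1} μ ≤ 0`: the treeʼs
  `integral_danskinDensity_laplacian_nonpos`, "on `λ₁^{q−1}`-average the top eigenvalue melts").
* § 3 (`T³`) **`exists_twin_of_exact_two`** — at `q = 2` an exact witness (indeed any smooth
  divergence-free field with `Φ₂ > 0` and `heatDissipation Φ₂ ≤ 0`) has a TWIN POINT of the top
  strain eigenvalue, `λ₂(x) = λ₁(x)` (the top eigenvalue is NOT SIMPLE there; zeros of the strain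
  qualify); `exists_twin_of_nonpos_of_gapPos` — the same for any real `q` under gap-positivity
  `∀ η ∈ (0,1], TopEigGapCoercivePos q η` (a tree theorem for `q ≥ 2`);
  `exists_near_biaxial_of_exact_two` — an exact witness at `q = 2` is `η`-near-biaxial somewhere,
  `(1−η)λ₁(x) < λ₂(x)`, for EVERY `η > 0` (quantitative form for rate-`ε` violators = the treeʼs
  `TopEigGapNearBiaxial.exists_midEig_gt_of_heatDissipation_lt`: a `(9ε/2π²)`-near-biaxial point).
* § 4 (`T³`) **`dirTopEig_eq_zero_ae_of_nonneg_on_pos`** — "STATIONARY ⇒ FLAT a.e.": if `μ ≥ 0` at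
  every point where `λ₁ > 0` (the pointwise heat-stationarity of K47 `NoGo/TopEigHeatStationary`,
  which makes the field exact for all `q > 1` at once), then `μ = 0` almost everywhere on
  `{λ₁ > 0}` — the only pointwise route to exactness is exact pointwise balance (Danskin at `q = 2`
  against the heat sieve); `exists_twin_of_nonneg_on_pos` — and such a field, if `Φ₂ > 0`, has a
  twin point `λ₂ = λ₁`.
* § 5 `exact_witness_portrait_two` / `exact_witness_portrait_of_gapPos` — the conjunctions; and the
  contrapositive for the search, `heatDissipation_topEigMoment_two_pos_of_simple`: an
  everywhere-SIMPLE top eigenvalue (`λ₂ < λ₁` at every point) with `Φ₂ > 0` has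
  `heatDissipation Φ₂ v > 0`.

MEANING FOR (F2): on top of K42–K47 (no zero-averaging translation symmetry, no independent flips,
non-calibrated, N_q thresholds, spectrally unbounded or exact, melting tops), an exact witness at
`q = 2` (at every `q ≥ 2`, with the treeʼs `TopEigGapCoerciveHigh`) must carry a twin point of the
top strain eigenvalue and balanced Danskin mass; a witness SEQUENCE is near-biaxial somewhere along
the sequence (tree `violators_outside_gap_of_not_pos`); for `1 < q < 2` § 1–2 and § 4 apply
unconditionally and § 3 only under the (open below `q = 2`) gap-positivity. CAVEAT (design value,
honest): a coincidence `λ₂ = λ₁` of eigenvalues of a symmetric matrix is a codimension-two event, so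
a GENERIC smooth field on `T³` already carries twin CURVES `{λ₂ = λ₁}` (and zeros of the strain are
twin points); § 3 therefore bites exactly the everywhere-simple designs — it retires "simple-top"
ansätze as exact witnesses and nothing more; for witness SEQUENCES the treeʼs quantitative gap-class
rates are the stronger statements. No node is decided; L-λ(q) stays OPEN in the kernel for every
real `q > 1`. [ours]
FILING (prove seat g29, REQUEST #74): declarations byte-identical to the no-go seat's staged `TopEigHeatExactWitness.STAGING.lean` 59d6cf85ead5eb18; this line is the only addition.
-/

noncomputable section

open MeasureTheory Set Filter Topology

namespace Summit.NavierStokesRegularity.FunctionalMining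

open Literature.Analysis.FunctionSpaces

namespace TopEig

variable {d : Type*} [Fintype d] [DecidableEq d] [Nonempty d]

/-! ## 1. Compactness: everywhere-simple top eigenvalue ⇒ a top-gap class -/

/-- **Everywhere-simple ⇒ some gap class.** A smooth field on `T^d` with `λ₂(x) < λ₁(x)` at every
point lies in the top-gap class `λ₂ ≤ (1−η)λ₁` for some `η ∈ (0, 1]`: `λ₁ − λ₂` has a positive
minimum `m` and `λ₁` a maximum `L` on the compact torus; `η = m / max L m`. [ours] -/
theorem exists_strainGapClass_of_midEig_lt {v : UnitAddTorus d → EuclideanSpace ℝ d}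
    (hv : Torus.IsSmooth v) (hlt : ∀ x, torusStrainMidEig v x < torusStrainTopEig v x) :
    ∃ η : ℝ, 0 < η ∧ η ≤ 1 ∧ StrainGapClass η v := by
  have hf : Continuous fun x => torusStrainTopEig v x - torusStrainMidEig v x :=
    (continuous_torusStrainTopEig hv).sub (continuous_torusStrainMidEig hv)
  obtain ⟨xm, -, hxm⟩ :=
    isCompact_univ.exists_isMinOn univ_nonempty hf.continuousOn
  obtain ⟨xM, -, hxM⟩ :=
    isCompact_univ.exists_isMaxOn univ_nonempty (continuous_torusStrainTopEig hv).continuousOn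
  set m : ℝ := torusStrainTopEig v xm - torusStrainMidEig v xm with hm
  set L : ℝ := torusStrainTopEig v xM with hL
  have hm0 : 0 < m := by rw [hm]; linarith [hlt xm]
  have hB0 : 0 < max L m := lt_max_of_lt_right hm0
  refine ⟨m / max L m, div_pos hm0 hB0, (div_le_one hB0).2 (le_max_right _ _), fun x => ?_⟩
  have hfx : m ≤ torusStrainTopEig v x - torusStrainMidEig v x := hxm (mem_univ x)
  have hkey : m / max L m * torusStrainTopEig v x ≤ m := by
    rcases le_or_gt (torusStrainTopEig v x) 0 with h0 | h0
    · exact (mul_nonpos_of_nonneg_of_nonpos (div_pos hm0 hB0).le h0).trans hm0.le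
    · calc m / max L m * torusStrainTopEig v x ≤ m / max L m * max L m :=
          mul_le_mul_of_nonneg_left ((hxM (mem_univ x)).trans (le_max_left _ _))
            (div_pos hm0 hB0).le
        _ = m := div_mul_cancel₀ _ hB0.ne'
  nlinarith

/-- **Outside every gap class ⇒ a non-simple top point.** A smooth field on `T^d` that lies in NO
top-gap class `η ∈ (0, 1]` has a point with `λ₁(x) ≤ λ₂(x)` (at `card d = 3`: `λ₁(x) = λ₂(x)`, a
twin point of the top strain eigenvalue; zeros of the strain qualify). [ours] -/
theorem exists_not_simple_of_forall_not_strainGapClass {v : UnitAddTorus d → EuclideanSpace ℝ d}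
    (hv : Torus.IsSmooth v) (h : ∀ η : ℝ, 0 < η → η ≤ 1 → ¬ StrainGapClass η v) :
    ∃ x, torusStrainTopEig v x ≤ torusStrainMidEig v x := by
  by_contra hne
  push Not at hne
  obtain ⟨η, hη0, hη1, hgap⟩ := exists_strainGapClass_of_midEig_lt hv hne
  exact h η hη0 hη1 hgap

/-- `λ₂ ≤ λ₁` on `T³` (the landed `NoGo/TopEigGapFloor.torusStrainMidEig_le_topEig`, re-derived from
`torusStrainMidEig_eq_eig_one` because that module is outside this fileʼs import closure).
[folklore] -/
private theorem midEig_le_topEig (v : UnitAddTorus (Fin 3) → EuclideanSpace ℝ (Fin 3))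
    (x : UnitAddTorus (Fin 3)) : torusStrainMidEig v x ≤ torusStrainTopEig v x := by
  obtain ⟨htop, hmid⟩ := torusStrainMidEig_eq_eig_one v x
  rw [htop, hmid]
  exact torusStrainEig_antitone v x (Fin.le_iff_val_le_val.2 (by simp))

/-- **Outside every gap class ⇒ a TWIN POINT `λ₂ = λ₁` (on `T³`).** [ours] -/
theorem exists_twin_of_forall_not_strainGapClass
    {v : UnitAddTorus (Fin 3) → EuclideanSpace ℝ (Fin 3)} (hv : Torus.IsSmooth v)
    (h : ∀ η : ℝ, 0 < η → η ≤ 1 → ¬ StrainGapClass η v) :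
    ∃ x, torusStrainMidEig v x = torusStrainTopEig v x := by
  obtain ⟨x, hx⟩ := exists_not_simple_of_forall_not_strainGapClass hv h
  exact ⟨x, le_antisymm (midEig_le_topEig v x) hx⟩

/-! ## 2. Exact ⇒ balanced Danskin mass

For EVERY smooth divergence-free field on `T³` and real `q ≥ 1` the Danskin mass is non-positive,
`∫ q λ₁^{q−1} μ(S;ΔS) ≤ 0` — the treeʼs `integral_danskinDensity_laplacian_nonpos`
(`TopEigProductionReverse`, the heat sieve read through Danskinʼs formula; "on `λ₁^{q−1}`-average
the top strain eigenvalue melts"). An exact witness sits at the boundary of that inequality. -/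

/-- **Exact ⇒ balanced Danskin mass**: `heatDissipation Φ_q v = 0` (smooth divergence-free `v` on
`T^d`, real `q ≥ 1`) gives `∫ q λ₁^{q−1} μ(S;ΔS) = 0`. [ours, bookkeeping] -/
theorem integral_danskinDensity_eq_zero_of_exact {q : ℝ} (hq : 1 ≤ q)
    {v : UnitAddTorus d → EuclideanSpace ℝ d} (hv : Torus.IsSmooth v) (hdiv : Torus.IsDivFree v)
    (hD : heatDissipation (torusTopEigMoment q) v = 0) :
    ∫ x, q * torusStrainTopEig v x ^ (q - 1) *
        dirTopEig (StrainL4.strainFlat v x) (StrainL4.strainFlat (Torus.laplacian v) x) = 0 := by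
  have h := heatDissipation_topEigMoment_eq_integral hq hv hdiv
  rw [hD] at h
  linarith

/-! ## 3. Exact witnesses have a twin point `λ₂ = λ₁` (`q = 2`; any `q` under gap-positivity) -/

/-- **Gap-positivity ⇒ an exact witness has a TWIN POINT of the top strain eigenvalue.** For a
real `q` with `TopEigGapCoercivePos q η` for every `η ∈ (0, 1]` (a tree theorem for every `q ≥ 2`:
`topEigGapCoercivePos_of_ge_two`), and `v` smooth, divergence free and zero mean on `T³` with
`Φ_q(v) > 0` and `heatDissipation Φ_q v ≤ 0`: there is a point with `λ₂(x) = λ₁(x)`. Otherwise `v`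
lies in a gap class `η > 0` (§ 1), where the positive rate `c·Φ_q(v) ≤ heatDissipation Φ_q v`
contradicts `Φ_q(v) > 0`. [ours] -/
theorem exists_twin_of_nonpos_of_gapPos {q : ℝ}
    (hpos : ∀ η : ℝ, 0 < η → η ≤ 1 → TopEigGapCoercivePos (d := Fin 3) q η)
    {v : UnitAddTorus (Fin 3) → EuclideanSpace ℝ (Fin 3)} (hv : Torus.IsSmooth v)
    (hdiv : Torus.IsDivFree v) (hzm : Torus.HasZeroMean v) (hΦ : 0 < torusTopEigMoment q v)
    (hD : heatDissipation (torusTopEigMoment q) v ≤ 0) :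
    ∃ x, torusStrainMidEig v x = torusStrainTopEig v x := by
  refine exists_twin_of_forall_not_strainGapClass hv fun η hη0 hη1 hgap => ?_
  obtain ⟨c, hc, hcoer⟩ := hpos η hη0 hη1
  have h1 : c * torusTopEigMoment q v ≤ heatDissipation (torusTopEigMoment q) v :=
    hcoer (by simp) v hv hdiv hzm hgap
  nlinarith [mul_pos hc hΦ]

/-- **An exact (F2) witness at `q = 2` has a TWIN POINT of the top strain eigenvalue** —
unconditionally: for `v` smooth and divergence free on `T³` with `Φ₂(v) > 0` and
`heatDissipation Φ₂ v ≤ 0` there is a point with `λ₂(x) = λ₁(x)` (zeros of the strain qualify).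
Otherwise `v` lies in a gap class `η > 0` (§ 1), where the treeʼs Proposition L-λ(η) at `q = 2`
(`topEigMoment_two_le_heatDissipation_of_gap`, rate `2π²η/9`) contradicts `Φ₂(v) > 0`. No
zero-mean hypothesis is needed. [ours] -/
theorem exists_twin_of_exact_two
    {v : UnitAddTorus (Fin 3) → EuclideanSpace ℝ (Fin 3)} (hv : Torus.IsSmooth v)
    (hdiv : Torus.IsDivFree v) (hΦ : 0 < torusTopEigMoment 2 v)
    (hD : heatDissipation (torusTopEigMoment 2) v ≤ 0) :
    ∃ x, torusStrainMidEig v x = torusStrainTopEig v x := by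
  refine exists_twin_of_forall_not_strainGapClass hv fun η hη0 hη1 hgap => ?_
  have h1 := topEigMoment_two_le_heatDissipation_of_gap hv hdiv hη0 hη1 hgap
  have h2 : 0 < 2 * Real.pi ^ 2 * η / 9 * torusTopEigMoment 2 v := by positivity
  linarith

/-- **An exact witness at `q = 2` is `η`-near-biaxial somewhere, for EVERY `η ∈ (0, 1]`**: a point
with `(1−η)λ₁(x) < λ₂(x)`. (Quantitative form for rate-`ε` violators,
`heatDissipation Φ₂ v < ε Φ₂(v)` ⇒ a `(9ε/2π²)`-near-biaxial point: the treeʼs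
`exists_midEig_gt_of_heatDissipation_lt` / `exists_midEig_gt_of_ratio_lt`, `TopEigGapNearBiaxial`.)
[ours, bookkeeping] -/
theorem exists_near_biaxial_of_exact_two
    {v : UnitAddTorus (Fin 3) → EuclideanSpace ℝ (Fin 3)} (hv : Torus.IsSmooth v)
    (hdiv : Torus.IsDivFree v) (hΦ : 0 < torusTopEigMoment 2 v)
    (hD : heatDissipation (torusTopEigMoment 2) v ≤ 0) {η : ℝ} (hη0 : 0 < η) (hη1 : η ≤ 1) :
    ∃ x, (1 - η) * torusStrainTopEig v x < torusStrainMidEig v x := by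
  rw [← not_strainGapClass_iff]
  intro hgap
  have h1 := topEigMoment_two_le_heatDissipation_of_gap hv hdiv hη0 hη1 hgap
  have h2 : 0 < 2 * Real.pi ^ 2 * η / 9 * torusTopEigMoment 2 v := by positivity
  linarith

/-! ## 4. Stationary ⇒ flat almost everywhere -/

/-- **STATIONARY ⇒ FLAT a.e.** For `v` smooth and divergence free on `T³`: if
`μ(S(x); ΔS(x)) ≥ 0` at every point with `λ₁(x) > 0` (pointwise heat-stationarity), then
`μ(S(x); ΔS(x)) = 0` for almost every `x` with `λ₁(x) > 0`. Proof: at `q = 2` the Danskin density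
`2λ₁μ` is then `≥ 0` pointwise while its integral is `−heatDissipation Φ₂ v ≤ 0` (heat sieve), so it
vanishes a.e. [ours] -/
theorem dirTopEig_eq_zero_ae_of_nonneg_on_pos
    {v : UnitAddTorus (Fin 3) → EuclideanSpace ℝ (Fin 3)} (hv : Torus.IsSmooth v)
    (hdiv : Torus.IsDivFree v)
    (h : ∀ x, 0 < torusStrainTopEig v x →
      0 ≤ dirTopEig (StrainL4.strainFlat v x) (StrainL4.strainFlat (Torus.laplacian v) x)) :
    ∀ᵐ x, 0 < torusStrainTopEig v x →
      dirTopEig (StrainL4.strainFlat v x) (StrainL4.strainFlat (Torus.laplacian v) x) = 0 := by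
  set g : UnitAddTorus (Fin 3) → ℝ := fun x => 2 * torusStrainTopEig v x ^ ((2 : ℝ) - 1) *
    dirTopEig (StrainL4.strainFlat v x) (StrainL4.strainFlat (Torus.laplacian v) x) with hg
  have h21 : ((2 : ℝ) - 1) = 1 := by norm_num
  have hl0 : ∀ x, 0 ≤ torusStrainTopEig v x := fun x => by
    rw [← lam_strainFlat]; exact lam_strainFlat_nonneg hv hdiv x
  have hg0 : ∀ x, 0 ≤ g x := fun x => by
    simp only [hg, h21, Real.rpow_one]
    rcases (hl0 x).eq_or_lt with hx | hx
    · rw [← hx]; simp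
    · exact mul_nonneg (mul_nonneg (by norm_num) hx.le) (h x hx)
  have hint : Integrable g volume :=
    integrable_danskinDensity (q := 2) (by norm_num) hv hv.laplacian hdiv
  have hI0 : ∫ x, g x ≤ 0 := integral_danskinDensity_laplacian_nonpos (q := 2) (by norm_num) hv hdiv
  have hI : ∫ x, g x = 0 := le_antisymm hI0 (integral_nonneg hg0)
  have hae : g =ᵐ[volume] 0 := (integral_eq_zero_iff_of_nonneg_ae (ae_of_all _ hg0) hint).1 hI
  filter_upwards [hae] with x hx hpos
  simp only [hg, h21, Real.rpow_one, Pi.zero_apply, mul_eq_zero] at hx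
  rcases hx with (hx | hx) | hx
  · norm_num at hx
  · exact absurd hx hpos.ne'
  · exact hx

/-- **A pointwise-stationary field with `Φ₂ > 0` has a twin point.** For `v` smooth and divergence
free on `T³` with `μ ≥ 0` wherever `λ₁ > 0` and `Φ₂(v) > 0`: some point has `λ₂(x) = λ₁(x)` (the
Danskin density `2λ₁μ` is `≥ 0` pointwise, so `heatDissipation Φ₂ v = −∫ 2λ₁μ ≤ 0`, and § 3 applies;
cf. K47 `NoGo/TopEigHeatStationary`: such a field is exact for every `q > 1`). [ours] -/
theorem exists_twin_of_nonneg_on_pos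
    {v : UnitAddTorus (Fin 3) → EuclideanSpace ℝ (Fin 3)} (hv : Torus.IsSmooth v)
    (hdiv : Torus.IsDivFree v) (hΦ : 0 < torusTopEigMoment 2 v)
    (h : ∀ x, 0 < torusStrainTopEig v x →
      0 ≤ dirTopEig (StrainL4.strainFlat v x) (StrainL4.strainFlat (Torus.laplacian v) x)) :
    ∃ x, torusStrainMidEig v x = torusStrainTopEig v x := by
  refine exists_twin_of_exact_two hv hdiv hΦ ?_
  have h21 : ((2 : ℝ) - 1) = 1 := by norm_num
  have hl0 : ∀ x, 0 ≤ torusStrainTopEig v x := fun x => by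
    rw [← lam_strainFlat]; exact lam_strainFlat_nonneg hv hdiv x
  have hg0 : ∀ x, 0 ≤ 2 * torusStrainTopEig v x ^ ((2 : ℝ) - 1) *
      dirTopEig (StrainL4.strainFlat v x) (StrainL4.strainFlat (Torus.laplacian v) x) := fun x => by
    simp only [h21, Real.rpow_one]
    rcases (hl0 x).eq_or_lt with hx | hx
    · rw [← hx]; simp
    · exact mul_nonneg (mul_nonneg (by norm_num) hx.le) (h x hx)
  rw [heatDissipation_topEigMoment_eq_integral (q := 2) (by norm_num) hv hdiv, neg_nonpos]
  exact integral_nonneg hg0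

/-! ## 5. The portrait -/

/-- **PORTRAIT OF AN EXACT (F2) WITNESS at `q = 2`.** A smooth divergence-free field on `T³` with
`Φ₂(v) > 0` and `heatDissipation Φ₂ v = 0` has balanced Danskin mass `∫ 2 λ₁ μ = 0` AND a point
where the top strain eigenvalue is not simple, `λ₁(x) ≤ λ₂(x)`, AND for every `η ∈ (0, 1]` a point
with `(1−η)λ₁(x) < λ₂(x)`. (K47 adds: `μ ≤ 0` at every local maximum of `λ₁`; § 4 adds: if moreover
pointwise stationary, `μ = 0` a.e. on `{λ₁ > 0}`.) [ours] -/
theorem exact_witness_portrait_two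
    {v : UnitAddTorus (Fin 3) → EuclideanSpace ℝ (Fin 3)} (hv : Torus.IsSmooth v)
    (hdiv : Torus.IsDivFree v) (hΦ : 0 < torusTopEigMoment 2 v)
    (hD : heatDissipation (torusTopEigMoment 2) v = 0) :
    (∫ x, 2 * torusStrainTopEig v x ^ ((2 : ℝ) - 1) *
        dirTopEig (StrainL4.strainFlat v x) (StrainL4.strainFlat (Torus.laplacian v) x) = 0) ∧
      (∃ x, torusStrainMidEig v x = torusStrainTopEig v x) ∧
      ∀ η : ℝ, 0 < η → η ≤ 1 → ∃ x, (1 - η) * torusStrainTopEig v x < torusStrainMidEig v x :=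
  ⟨integral_danskinDensity_eq_zero_of_exact (by norm_num) hv hdiv hD,
    exists_twin_of_exact_two hv hdiv hΦ hD.le,
    fun _ hη0 hη1 => exists_near_biaxial_of_exact_two hv hdiv hΦ hD.le hη0 hη1⟩

/-- **PORTRAIT under gap-positivity** (every real `q ≥ 1` with `TopEigGapCoercivePos q η` for all
`η ∈ (0, 1]`; a tree theorem for `q ≥ 2`): an admissible zero-mean exact witness with `Φ_q > 0` has
balanced Danskin mass and a twin point `λ₂ = λ₁`. [ours] -/
theorem exact_witness_portrait_of_gapPos {q : ℝ} (hq : 1 ≤ q)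
    (hpos : ∀ η : ℝ, 0 < η → η ≤ 1 → TopEigGapCoercivePos (d := Fin 3) q η)
    {v : UnitAddTorus (Fin 3) → EuclideanSpace ℝ (Fin 3)} (hv : Torus.IsSmooth v)
    (hdiv : Torus.IsDivFree v) (hzm : Torus.HasZeroMean v) (hΦ : 0 < torusTopEigMoment q v)
    (hD : heatDissipation (torusTopEigMoment q) v = 0) :
    (∫ x, q * torusStrainTopEig v x ^ (q - 1) *
        dirTopEig (StrainL4.strainFlat v x) (StrainL4.strainFlat (Torus.laplacian v) x) = 0) ∧
      ∃ x, torusStrainMidEig v x = torusStrainTopEig v x :=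
  ⟨integral_danskinDensity_eq_zero_of_exact hq hv hdiv hD,
    exists_twin_of_nonpos_of_gapPos hpos hv hdiv hzm hΦ hD.le⟩

/-- **Contrapositive for the search (`q = 2`)**: a smooth divergence-free field on `T³` whose top
strain eigenvalue is SIMPLE at every point (`λ₂ < λ₁` everywhere) and with `Φ₂ > 0` has STRICTLY
POSITIVE heat dissipation of `Φ₂` — it is never an exact witness at `q = 2`. [ours] -/
theorem heatDissipation_topEigMoment_two_pos_of_simple
    {v : UnitAddTorus (Fin 3) → EuclideanSpace ℝ (Fin 3)} (hv : Torus.IsSmooth v)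
    (hdiv : Torus.IsDivFree v) (hΦ : 0 < torusTopEigMoment 2 v)
    (hlt : ∀ x, torusStrainMidEig v x < torusStrainTopEig v x) :
    0 < heatDissipation (torusTopEigMoment 2) v := by
  by_contra hle
  obtain ⟨x, hx⟩ := exists_twin_of_exact_two hv hdiv hΦ (not_lt.1 hle)
  exact absurd (hlt x) (not_lt.2 hx.ge)

/-- The same under gap-positivity, for a real `q` and admissible zero-mean fields. [ours,
bookkeeping] -/
theorem heatDissipation_topEigMoment_pos_of_simple_of_gapPos {q : ℝ}
    (hpos : ∀ η : ℝ, 0 < η → η ≤ 1 → TopEigGapCoercivePos (d := Fin 3) q η)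
    {v : UnitAddTorus (Fin 3) → EuclideanSpace ℝ (Fin 3)} (hv : Torus.IsSmooth v)
    (hdiv : Torus.IsDivFree v) (hzm : Torus.HasZeroMean v) (hΦ : 0 < torusTopEigMoment q v)
    (hlt : ∀ x, torusStrainMidEig v x < torusStrainTopEig v x) :
    0 < heatDissipation (torusTopEigMoment q) v := by
  by_contra hle
  obtain ⟨x, hx⟩ := exists_twin_of_nonpos_of_gapPos hpos hv hdiv hzm hΦ (not_lt.1 hle)
  exact absurd (hlt x) (not_lt.2 hx.ge)

end TopEig

end Summit.NavierStokesRegularity.FunctionalMining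

end

-- search for candidate a priori estimates; no regularity claim
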